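import Summits.QuantumFields.GaugeBoot.TiltedBoxOddAxisGeometry
import Summits.QuantumFields.GaugeBoot.TiltedLinkRPHolonomy
import Summits.QuantumFields.GaugeBoot.TwistedSlabHaar
import HarnessLib

/-!
# The twisted slab of the odd square tilted box: slab plaquettes as weights on the layer above (gauge-boot, L3 negative supplement; twisted-slab mechanism, box bookkeeping)

HONEST FRAMING (cell `pub-gaugeboot`, page 1 of every file): the venture produces certified bounds
on lattice expectations at stated coupling, gauge group, dimension and torus size; NOT a mass gap,
NOT a continuum limit, NOT a string tension; NOT Yang–Mills-summit-bearing (barriers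
`FixedCouplingUltralocality`, `PerturbativeInvisibility`). Bookkeeping for the NEGATIVE result
`TiltedBoxOddAxisRPNegative.lean`.

The SLAB of the odd square box (`TiltedBoxOddAxisGeometry.lean`) consists of the plaquettes with
an `i`-side based in the layer `x_i ≡ P` (`IsSlabPlaq`). Each is read through the link of the layer
`x_i ≡ P + 1` ABOVE it: the slab plaquette `(y; i, m)` has holonomy `C₁ B C₂⁻¹ A⁻¹` with
`A = U(y, m)` (layer `P`), `B = U(y + e_i, m)` (layer `P + 1`), `C₁ = U(y, i)`, `C₂ = U(y + e_m, i)`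
(crossing links), so its Boltzmann factor is `w_β(a_t B⁻¹ b_t)` with `t = (y + e_i, m)`,
`a_t = A C₂`, `b_t = C₁⁻¹` (`slabA`, `slabB`; guarded by membership in the block so that they are
defined on all links) — exactly the shape of `TwistedSlab.slab_integral_frozen`:

* `slabBlock` — the links `(y', m)`, `x_i(y') = P + 1`, `m ≠ i`; `mkDirPair`; the bijection slab
  plaquettes ↔ block links and **`prod_exp_slab_eq`**:
  `∏_{p slab} exp(β Re tr ρ(U_p)) = ∏_{t ∈ slabBlock} w_β(a_t(U) U_t⁻¹ b_t(U))`;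
* `slabA`/`slabB` are continuous and depend only on links OFF the block
  (`dependsOn_slabA/B`), as does the observable of a plaquette inside the layer `P`
  (`dependsOn_plaqObs_layer`);
* for a transverse plaquette `q = (y + e_i; a, b)` of the layer `P + 1` (`a, b ≠ i`): its four links
  lie in the block (`mem_slabBlock_…`) and **`re_trace_slabWord`**: the word
  `b₀a₀b₁a₁a₂⁻¹b₂⁻¹a₃⁻¹b₃⁻¹` of `slab_integral` is `U(y,i)⁻¹ · U_{(y; a, b)} · U(y,i)`, so its
  `Re tr ρ` is the observable of the plaquette `(y; a, b)` BELOW `q` — the slab transfers plaquette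
  observables one layer down.

Everything is `[folklore]` bookkeeping.

References: K. Osterwalder, E. Seiler, Ann. Phys. 110 (1978) 440, §2; J. Fröhlich, R. Israel,
E. H. Lieb, B. Simon, J. Stat. Phys. 22 (1980) 297, §3.
-/

noncomputable section

open QuotientAddGroup
open Literature.RepresentationTheory.CompactGroups

namespace Summit.QuantumFields.GaugeBoot

namespace TiltedRP

section Slab

variable {d : ℕ} {i j : Fin d} {L P : ℕ}

/-! ## Direction pairs containing `i` -/

/-- The ordered direction pair `{i, m}` for `m ≠ i`. [folklore] -/
def mkDirPair (i m : Fin d) (hm : m ≠ i) : DirPair d :=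
  if h : i < m then ⟨(i, m), h⟩ else ⟨(m, i), lt_of_le_of_ne (not_lt.1 h) hm⟩

/-- `mkDirPair i m` contains `i`. [folklore] -/
theorem mkDirPair_hasDir (i m : Fin d) (hm : m ≠ i) :
    (mkDirPair i m hm).1.1 = i ∨ (mkDirPair i m hm).1.2 = i := by
  unfold mkDirPair; split_ifs <;> simp

/-- The other direction of `mkDirPair i m` is `m`. [folklore] -/
theorem otherDir_mkDirPair {A : Type*} [AddCommGroup A] (x : A) (i m : Fin d) (hm : m ≠ i) :
    otherDir i ((x, mkDirPair i m hm) : A × DirPair d) = m := by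
  unfold otherDir mkDirPair
  by_cases h : i < m
  · rw [dif_pos h]; simp
  · rw [dif_neg h]; simp [hm]

/-- A direction pair containing `i` is `mkDirPair i (otherDir)`. [folklore] -/
theorem mkDirPair_otherDir {A : Type*} [AddCommGroup A] (p : A × DirPair d) (hp : p.2.1.1 = i ∨ p.2.1.2 = i) :
    mkDirPair i (otherDir i p) (otherDir_ne hp) = p.2 := by
  obtain ⟨x, ⟨⟨a, b⟩, hab⟩⟩ := p
  simp only [otherDir] at *
  rcases hp with h | h
  · simp only at h; subst h
    have hne : ¬ b = a := fun hh => (lt_irrefl a) (hh ▸ hab)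
    simp only [if_true, mkDirPair, dif_pos hab]
  · simp only at h; subst h
    have hne : ¬ a = b := fun hh => (lt_irrefl b) (hh ▸ hab)
    simp only [hne, if_false, mkDirPair, dif_neg (not_lt.2 hab.le)]

/-! ## The block above the slab and the frozen neighbours -/

variable [NeZero L]

/-- **A block link**: a link `(y', m)` of the layer `x_i(y') = P + 1` with `m ≠ i`. [folklore] -/
def IsBlockLink (t : Link (TiltedSite d i j (2 * P + 1) (2 * P + 1) L) d) : Prop :=
  axisCoord d L (2 * P + 1) t.1 = ((P : ℕ) : ZMod (2 * P + 1)) + 1 ∧ t.2 ≠ i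

/-- `IsBlockLink` is decidable. [folklore] -/
instance (t : Link (TiltedSite d i j (2 * P + 1) (2 * P + 1) L) d) : Decidable (IsBlockLink (P := P) t) := by
  unfold IsBlockLink; infer_instance

/-- **The block**: the finite set of block links. [folklore] -/
def slabBlock (d : ℕ) (i j : Fin d) (L P : ℕ) [NeZero L] :
    Finset (Link (TiltedSite d i j (2 * P + 1) (2 * P + 1) L) d) :=
  Finset.univ.filter (IsBlockLink (P := P))

/-- Membership in the block. [folklore] -/
theorem mem_slabBlock {t : Link (TiltedSite d i j (2 * P + 1) (2 * P + 1) L) d} :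
    t ∈ slabBlock d i j L P ↔ axisCoord d L (2 * P + 1) t.1 = ((P : ℕ) : ZMod (2 * P + 1)) + 1 ∧ t.2 ≠ i := by
  simp [slabBlock, IsBlockLink]

/-- Membership in the block is the block predicate. [folklore] -/
theorem isBlockLink_iff {t : Link (TiltedSite d i j (2 * P + 1) (2 * P + 1) L) d} :
    IsBlockLink (P := P) t ↔ t ∈ slabBlock d i j L P := by
  simp [slabBlock]

variable {G : Type*} [Group G] [DecidableEq (TiltedSite d i j (2 * P + 1) (2 * P + 1) L)]

/-- The frozen neighbour `a_t = U(y, m) U(y + e_m, i)` of the block link `t = (y + e_i, m)` (and `1`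
off the block). [folklore] -/
def slabA (t : Link (TiltedSite d i j (2 * P + 1) (2 * P + 1) L) d)
    (U : Config (TiltedSite d i j (2 * P + 1) (2 * P + 1) L) d G) : G :=
  if IsBlockLink (P := P) t then
    U (t.1 - tiltedUnit d i j (2 * P + 1) (2 * P + 1) L i, t.2) *
      U (t.1 - tiltedUnit d i j (2 * P + 1) (2 * P + 1) L i + tiltedUnit d i j (2 * P + 1) (2 * P + 1) L t.2, i)
  else 1

/-- The frozen neighbour `b_t = U(y, i)⁻¹` of the block link `t = (y + e_i, m)` (and `1` off the
block). [folklore] -/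
def slabB (t : Link (TiltedSite d i j (2 * P + 1) (2 * P + 1) L) d)
    (U : Config (TiltedSite d i j (2 * P + 1) (2 * P + 1) L) d G) : G :=
  if IsBlockLink (P := P) t then (U (t.1 - tiltedUnit d i j (2 * P + 1) (2 * P + 1) L i, i))⁻¹ else 1

omit [DecidableEq (TiltedSite d i j (2 * P + 1) (2 * P + 1) L)] in
/-- A link of direction `i` is not in the block. [folklore] -/
theorem not_mem_slabBlock_of_dir (x : TiltedSite d i j (2 * P + 1) (2 * P + 1) L) :
    (x, i) ∉ slabBlock d i j L P := fun h => (mem_slabBlock.1 h).2 rfl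

omit [DecidableEq (TiltedSite d i j (2 * P + 1) (2 * P + 1) L)] in
/-- A link based in the layer `P` is not in the block (`P ≥ 1`). [folklore] -/
theorem not_mem_slabBlock_of_layer [NeZero P] {x : TiltedSite d i j (2 * P + 1) (2 * P + 1) L}
    (hx : axisCoord d L (2 * P + 1) x = ((P : ℕ) : ZMod (2 * P + 1))) (m : Fin d) :
    (x, m) ∉ slabBlock d i j L P := by
  intro h
  have h1 := (mem_slabBlock.1 h).1
  rw [hx] at h1
  have h2 : (1 : ZMod (2 * P + 1)) = 0 := by
    have := congrArg (fun z => z - ((P : ℕ) : ZMod (2 * P + 1))) h1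
    simpa using this.symm
  have hM1 : 2 * P + 1 ≠ 1 := by have := NeZero.ne P; omega
  exact one_ne_zero ((ZMod.val_eq_zero _).2 h2 ▸ (ZMod.val_one'' hM1).symm)

omit [DecidableEq (TiltedSite d i j (2 * P + 1) (2 * P + 1) L)] in
/-- The base point below a block link lies in the layer `P`. [folklore] -/
theorem axisCoord_sub_of_mem_slabBlock {t : Link (TiltedSite d i j (2 * P + 1) (2 * P + 1) L) d}
    (ht : t ∈ slabBlock d i j L P) :
    axisCoord d L (2 * P + 1) (t.1 - tiltedUnit d i j (2 * P + 1) (2 * P + 1) L i) =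
      ((P : ℕ) : ZMod (2 * P + 1)) := by
  rw [map_sub, (mem_slabBlock.1 ht).1, axisCoord_tiltedUnit_self, add_sub_cancel_right]

/-- `a_t` depends only on links off the block. [folklore] -/
theorem dependsOn_slabA [NeZero P] (t : Link (TiltedSite d i j (2 * P + 1) (2 * P + 1) L) d) :
    DependsOn (slabA (G := G) t) (((slabBlock d i j L P)ᶜ : Finset _) : Set _) := by
  intro U V hUV
  unfold slabA
  by_cases ht : IsBlockLink (P := P) t
  · have ht' : t ∈ slabBlock d i j L P := isBlockLink_iff.1 ht
    rw [if_pos ht, if_pos ht,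
      hUV _ (by simpa using not_mem_slabBlock_of_layer (axisCoord_sub_of_mem_slabBlock ht') t.2),
      hUV _ (by simpa using not_mem_slabBlock_of_dir _)]
  · rw [if_neg ht, if_neg ht]

/-- `b_t` depends only on links off the block. [folklore] -/
theorem dependsOn_slabB (t : Link (TiltedSite d i j (2 * P + 1) (2 * P + 1) L) d) :
    DependsOn (slabB (G := G) t) (((slabBlock d i j L P)ᶜ : Finset _) : Set _) := by
  intro U V hUV
  unfold slabB
  by_cases ht : IsBlockLink (P := P) t
  · rw [if_pos ht, if_pos ht, hUV _ (by simpa using not_mem_slabBlock_of_dir _)]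
  · rw [if_neg ht, if_neg ht]

/-- The observable of a plaquette whose four links are off the block depends only on links off the
block; in particular for a plaquette inside the layer `P`. [folklore] -/
theorem dependsOn_plaqObs_layer [NeZero P] {N : ℕ} (ρ : G →* Matrix (Fin N) (Fin N) ℂ)
    (p : Plaq (TiltedSite d i j (2 * P + 1) (2 * P + 1) L) d)
    (hp : axisCoord d L (2 * P + 1) p.1 = ((P : ℕ) : ZMod (2 * P + 1))) (ha : p.2.1.1 ≠ i) (hb : p.2.1.2 ≠ i) :
    DependsOn (fun U : Config (TiltedSite d i j (2 * P + 1) (2 * P + 1) L) d G =>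
      plaqObs ρ (tiltedUnit d i j (2 * P + 1) (2 * P + 1) L) p U) (((slabBlock d i j L P)ᶜ : Finset _) : Set _) := by
  intro U V hUV
  have h1 : axisCoord d L (2 * P + 1) (p.1 + tiltedUnit d i j (2 * P + 1) (2 * P + 1) L p.2.1.1) =
      ((P : ℕ) : ZMod (2 * P + 1)) := by rw [axisCoord_add_tiltedUnit, if_neg ha, add_zero, hp]
  have h2 : axisCoord d L (2 * P + 1) (p.1 + tiltedUnit d i j (2 * P + 1) (2 * P + 1) L p.2.1.2) =
      ((P : ℕ) : ZMod (2 * P + 1)) := by rw [axisCoord_add_tiltedUnit, if_neg hb, add_zero, hp]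
  dsimp only
  unfold plaqObs
  rw [holonomy_congr _ p.1 p.2.1.1 p.2.1.2
    (hUV _ (by simpa using not_mem_slabBlock_of_layer hp _))
    (hUV _ (by simpa using not_mem_slabBlock_of_layer h1 _))
    (hUV _ (by simpa using not_mem_slabBlock_of_layer h2 _))
    (hUV _ (by simpa using not_mem_slabBlock_of_layer hp _))]

section Continuity

variable [TopologicalSpace G] [IsTopologicalGroup G]

omit [NeZero L] [DecidableEq (TiltedSite d i j (2 * P + 1) (2 * P + 1) L)] in
/-- `a_t` is continuous. [folklore] -/
theorem continuous_slabA (t : Link (TiltedSite d i j (2 * P + 1) (2 * P + 1) L) d) :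
    Continuous (slabA (G := G) (L := L) (P := P) t) := by
  unfold slabA
  by_cases ht : IsBlockLink (P := P) t
  · simp only [if_pos ht]
    exact (continuous_apply _).mul (continuous_apply _)
  · simp only [if_neg ht]
    exact continuous_const

omit [NeZero L] [DecidableEq (TiltedSite d i j (2 * P + 1) (2 * P + 1) L)] in
/-- `b_t` is continuous. [folklore] -/
theorem continuous_slabB (t : Link (TiltedSite d i j (2 * P + 1) (2 * P + 1) L) d) :
    Continuous (slabB (G := G) (L := L) (P := P) t) := by
  unfold slabB
  by_cases ht : IsBlockLink (P := P) t
  · simp only [if_pos ht]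
    exact (continuous_apply _).inv
  · simp only [if_neg ht]
    exact continuous_const

end Continuity

/-! ## The slab plaquettes are the weights of the block -/

variable {N : ℕ} [TopologicalSpace G] [IsTopologicalGroup G] [CompactSpace G]
  (ρ : G →* Matrix (Fin N) (Fin N) ℂ)

omit [NeZero L] [DecidableEq (TiltedSite d i j (2 * P + 1) (2 * P + 1) L)] in
/-- The Boltzmann factor of one slab plaquette is the weight of the block link above it. [folklore] -/
theorem exp_plaqObs_slab_eq [NeZero P] (hρ : Continuous ρ) (β : ℝ)
    (U : Config (TiltedSite d i j (2 * P + 1) (2 * P + 1) L) d G)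
    {p : Plaq (TiltedSite d i j (2 * P + 1) (2 * P + 1) L) d} (hdir : p.2.1.1 = i ∨ p.2.1.2 = i)
    (hlay : axisCoord d L (2 * P + 1) p.1 = ((P : ℕ) : ZMod (2 * P + 1))) :
    Real.exp (β * plaqObs ρ (tiltedUnit d i j (2 * P + 1) (2 * P + 1) L) p U) =
      TwistedSlab.wilsonWeight ρ β
        (slabA (p.1 + tiltedUnit d i j (2 * P + 1) (2 * P + 1) L i, otherDir i p) U *
          (U (p.1 + tiltedUnit d i j (2 * P + 1) (2 * P + 1) L i, otherDir i p))⁻¹ *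
          slabB (p.1 + tiltedUnit d i j (2 * P + 1) (2 * P + 1) L i, otherDir i p) U) := by
  have ht : IsBlockLink (P := P) (p.1 + tiltedUnit d i j (2 * P + 1) (2 * P + 1) L i, otherDir i p) := by
    refine ⟨?_, otherDir_ne hdir⟩
    show axisCoord d L (2 * P + 1) (p.1 + tiltedUnit d i j (2 * P + 1) (2 * P + 1) L i) = _
    rw [axisCoord_add_tiltedUnit, if_pos rfl, hlay]
  rw [IsSiteFrame.plaqObs_of_hasDir ρ hρ hdir, TwistedSlab.wilsonWeight,
    ← CompactGroup.re_trace_map_inv ρ hρ]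
  have hX : (holonomy (tiltedUnit d i j (2 * P + 1) (2 * P + 1) L) U p.1 i (otherDir i p))⁻¹ =
      slabA (p.1 + tiltedUnit d i j (2 * P + 1) (2 * P + 1) L i, otherDir i p) U *
        (U (p.1 + tiltedUnit d i j (2 * P + 1) (2 * P + 1) L i, otherDir i p))⁻¹ *
        slabB (p.1 + tiltedUnit d i j (2 * P + 1) (2 * P + 1) L i, otherDir i p) U := by
    simp only [slabA, slabB, if_pos ht, holonomy, add_sub_cancel_right]
    group
  rw [hX]

omit [DecidableEq (TiltedSite d i j (2 * P + 1) (2 * P + 1) L)] in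
open scoped Classical in
/-- **The Boltzmann factor of the slab, read on the block**:
`∏_{p slab} exp(β Re tr ρ(U_p)) = ∏_{t ∈ slabBlock} w_β(a_t(U) U_t⁻¹ b_t(U))`. [folklore] -/
theorem prod_exp_slab_eq [NeZero P] (hρ : Continuous ρ) (β : ℝ)
    (U : Config (TiltedSite d i j (2 * P + 1) (2 * P + 1) L) d G) :
    ∏ p ∈ Finset.univ.filter (IsSlabPlaq (P := P)),
        Real.exp (β * plaqObs ρ (tiltedUnit d i j (2 * P + 1) (2 * P + 1) L) p U) =
      ∏ t ∈ slabBlock d i j L P, TwistedSlab.wilsonWeight ρ β (slabA t U * (U t)⁻¹ * slabB t U) := by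
  refine Finset.prod_bij'
    (fun p _ => (p.1 + tiltedUnit d i j (2 * P + 1) (2 * P + 1) L i, otherDir i p))
    (fun t ht => (t.1 - tiltedUnit d i j (2 * P + 1) (2 * P + 1) L i, mkDirPair i t.2 (mem_slabBlock.1 ht).2))
    (fun p hp => ?_) (fun t ht => ?_) (fun p hp => ?_) (fun t ht => ?_) (fun p hp => ?_)
  · -- into the block
    rw [Finset.mem_filter] at hp
    obtain ⟨-, hdir, hlay⟩ := hp
    rw [mem_slabBlock]
    refine ⟨?_, otherDir_ne hdir⟩
    show axisCoord d L (2 * P + 1) (p.1 + tiltedUnit d i j (2 * P + 1) (2 * P + 1) L i) = _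
    rw [axisCoord_add_tiltedUnit, if_pos rfl, hlay]
  · -- back to the slab
    rw [Finset.mem_filter]
    exact ⟨Finset.mem_univ _, mkDirPair_hasDir i t.2 (mem_slabBlock.1 ht).2, axisCoord_sub_of_mem_slabBlock ht⟩
  · -- left inverse
    rw [Finset.mem_filter] at hp
    obtain ⟨-, hdir, -⟩ := hp
    ext1
    · exact add_sub_cancel_right _ _
    · exact mkDirPair_otherDir p hdir
  · -- right inverse
    ext1
    · exact sub_add_cancel _ _
    · exact otherDir_mkDirPair _ i t.2 (mem_slabBlock.1 ht).2
  · -- the value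
    rw [Finset.mem_filter] at hp
    obtain ⟨-, hdir, hlay⟩ := hp
    exact exp_plaqObs_slab_eq ρ hρ β U hdir hlay

/-! ## A transverse plaquette of the layer above the slab -/

section Above

variable (y : TiltedSite d i j (2 * P + 1) (2 * P + 1) L) {a b : Fin d} (ha : a ≠ i) (hb : b ≠ i)
  (hy : axisCoord d L (2 * P + 1) y = ((P : ℕ) : ZMod (2 * P + 1)))
include ha hb hy

omit [Group G] [TopologicalSpace G] [IsTopologicalGroup G] [CompactSpace G] [DecidableEq (TiltedSite d i j (2 * P + 1) (2 * P + 1) L)] ha hb in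
/-- The links of the plaquette `(y + e_i; a, b)` lie in the block. [folklore] -/
theorem mem_slabBlock_above (c : Fin d) (hc : c ≠ i) (v : TiltedSite d i j (2 * P + 1) (2 * P + 1) L)
    (hv : axisCoord d L (2 * P + 1) v = 0) :
    (y + tiltedUnit d i j (2 * P + 1) (2 * P + 1) L i + v, c) ∈ slabBlock d i j L P := by
  rw [mem_slabBlock]
  refine ⟨?_, hc⟩
  show axisCoord d L (2 * P + 1) (y + tiltedUnit d i j (2 * P + 1) (2 * P + 1) L i + v) = _
  rw [map_add, axisCoord_add_tiltedUnit, if_pos rfl, hy, hv, add_zero]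

omit [TopologicalSpace G] [IsTopologicalGroup G] [CompactSpace G]
  [DecidableEq (TiltedSite d i j (2 * P + 1) (2 * P + 1) L)] in
/-- **The slab word is the conjugated holonomy of the plaquette below**:
`Re tr ρ(b₀a₀b₁a₁a₂⁻¹b₂⁻¹a₃⁻¹b₃⁻¹) = Re tr ρ(U_{(y; a, b)})` for the four block links
`t₀ = (y+e_i, a)`, `t₁ = (y+e_i+e_a, b)`, `t₂ = (y+e_i+e_b, a)`, `t₃ = (y+e_i, b)` of the plaquette
`(y + e_i; a, b)`. [folklore] -/
theorem re_trace_slabWord [NeZero P]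
    (U : Config (TiltedSite d i j (2 * P + 1) (2 * P + 1) L) d G) :
    ((ρ (slabB (y + tiltedUnit d i j (2 * P + 1) (2 * P + 1) L i, a) U *
        slabA (y + tiltedUnit d i j (2 * P + 1) (2 * P + 1) L i, a) U *
        slabB (y + tiltedUnit d i j (2 * P + 1) (2 * P + 1) L i + tiltedUnit d i j (2 * P + 1) (2 * P + 1) L a, b) U *
        slabA (y + tiltedUnit d i j (2 * P + 1) (2 * P + 1) L i + tiltedUnit d i j (2 * P + 1) (2 * P + 1) L a, b) U *
        (slabA (y + tiltedUnit d i j (2 * P + 1) (2 * P + 1) L i + tiltedUnit d i j (2 * P + 1) (2 * P + 1) L b, a) U)⁻¹ *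
        (slabB (y + tiltedUnit d i j (2 * P + 1) (2 * P + 1) L i + tiltedUnit d i j (2 * P + 1) (2 * P + 1) L b, a) U)⁻¹ *
        (slabA (y + tiltedUnit d i j (2 * P + 1) (2 * P + 1) L i, b) U)⁻¹ *
        (slabB (y + tiltedUnit d i j (2 * P + 1) (2 * P + 1) L i, b) U)⁻¹)).trace).re =
      ((ρ (holonomy (tiltedUnit d i j (2 * P + 1) (2 * P + 1) L) U y a b)).trace).re := by
  have h0 : IsBlockLink (P := P) (y + tiltedUnit d i j (2 * P + 1) (2 * P + 1) L i, a) :=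
    isBlockLink_iff.2 (by simpa using mem_slabBlock_above y hy a ha 0 (map_zero _))
  have h3 : IsBlockLink (P := P) (y + tiltedUnit d i j (2 * P + 1) (2 * P + 1) L i, b) :=
    isBlockLink_iff.2 (by simpa using mem_slabBlock_above y hy b hb 0 (map_zero _))
  have h1 : IsBlockLink (P := P)
      (y + tiltedUnit d i j (2 * P + 1) (2 * P + 1) L i + tiltedUnit d i j (2 * P + 1) (2 * P + 1) L a, b) :=
    isBlockLink_iff.2 (mem_slabBlock_above y hy b hb _ (axisCoord_tiltedUnit_of_ne d L _ ha))
  have h2 : IsBlockLink (P := P)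
      (y + tiltedUnit d i j (2 * P + 1) (2 * P + 1) L i + tiltedUnit d i j (2 * P + 1) (2 * P + 1) L b, a) :=
    isBlockLink_iff.2 (mem_slabBlock_above y hy a ha _ (axisCoord_tiltedUnit_of_ne d L _ hb))
  have e1 : y + tiltedUnit d i j (2 * P + 1) (2 * P + 1) L i + tiltedUnit d i j (2 * P + 1) (2 * P + 1) L a -
      tiltedUnit d i j (2 * P + 1) (2 * P + 1) L i = y + tiltedUnit d i j (2 * P + 1) (2 * P + 1) L a := by abel
  have e2 : y + tiltedUnit d i j (2 * P + 1) (2 * P + 1) L i + tiltedUnit d i j (2 * P + 1) (2 * P + 1) L b -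
      tiltedUnit d i j (2 * P + 1) (2 * P + 1) L i = y + tiltedUnit d i j (2 * P + 1) (2 * P + 1) L b := by abel
  have e3 : y + tiltedUnit d i j (2 * P + 1) (2 * P + 1) L b + tiltedUnit d i j (2 * P + 1) (2 * P + 1) L a =
      y + tiltedUnit d i j (2 * P + 1) (2 * P + 1) L a + tiltedUnit d i j (2 * P + 1) (2 * P + 1) L b := by abel
  rw [← congrArg Complex.re (CompactGroup.trace_conj_eq ρ
    (holonomy (tiltedUnit d i j (2 * P + 1) (2 * P + 1) L) U y a b) (U (y, i))⁻¹)]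
  congr 3
  simp only [slabA, slabB, if_pos h0, if_pos h1, if_pos h2, if_pos h3, add_sub_cancel_right, e1, e2, e3, holonomy]
  group

end Above

end Slab

end TiltedRP

end Summit.QuantumFields.GaugeBoot

end
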